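import Summits.SmoothPoincare4.SmoothPoincare4.Theses.EntropyRung
import Summits.SmoothPoincare4.SmoothPoincare4.Theorems.EntropyRungSubcylindricalExistenceGluingConformalRead
import HarnessLib

/-!
# Two-piece localisation of the weighted `𝒲`-clause (line `green-blowup-conformal-entropy`,
# crux `EntropyRung.SubcylindricalExistence`, stmt-SmoothPoincare4-10871; helper for Stub D)

The small-scale step of the lead's assembly `stub_conformalGluing` (reshape R-c2). On the fixed
background `(M, g, dV_g)` consider the `ψ`-weighted `w²`-form of Perelman's functional of the
conformal metric `ψ² g`,
`E(w) = ∫ [τ(r w² + 4ψ⁻²|∇w|²_g) − w² log w² − 4w²] c ψ⁴ dV_g`, `c = (4πτ)⁻²`, `r = ψ⁻³ L_g ψ ≥ 0`.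
Given a smooth partition `χ₁² + χ₂² = 1` whose pieces are supported in regions `U₁`, `U₂` on which
the clause holds (at the scale `τ`) at levels `L₁`, `L₂`, a Yamabe–Sobolev inequality for the weight
`ψ` with constant `Y`, and a bound `√(∫ (|∇χ₁|² + |∇χ₂|²)² dV_g) ≤ Θ`, every normalised smooth `w`
satisfies `E(w) ≥ L` as soon as `L < 0` and `L + (4/Y) C_Y⁺ Θ ≤ min(L₁, L₂)`,
`C_Y = 3(4 + 2 log(4π) − 2 log Y) + 6 log 6 − 6`:
* if `E(w) ≥ 0 > L` there is nothing to prove;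
* otherwise the IMS localisation inequality (H1 `wEntropy_localisation_two`, p102169, applied to the
  realised metric `ψ² g` and read back on `g` by the conformal laws `R' = ψ⁻³L_gψ`,
  `|∇·|²' = ψ⁻²|∇·|²`, `dV' = ψ⁴ dV`) gives `E(w) ≥ Σᵢ (E(χᵢw) + mᵢ log mᵢ) − 4τ ∫ c w² ψ² Σ|∇χᵢ|²_g`,
  the pieces satisfy `E(χᵢ w) + mᵢ log mᵢ = mᵢ E(ŵᵢ) ≥ mᵢ Lᵢ` (`ŵᵢ = χᵢw/√mᵢ` normalised; for
  `mᵢ = 0` the left side is `≥ 0` directly), `m₁ + m₂ = 1`, and the cost is `≤ (4/Y) C_Y⁺ Θ` by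
  `gluingCutoffCost` (p112238) since `E(w) < 0`.
Everything is proved; no definitions, no named facts.
-/

noncomputable section

set_option linter.dupNamespace false

open scoped Manifold ContDiff Topology ENNReal
open Set Filter MeasureTheory
open Literature.Geometry.Lorentzian

namespace Summit.SmoothPoincare4.SmoothPoincare4.Theorems

namespace GluingLocalisation

variable {M : Type} [TopologicalSpace M] [T2Space M] [SecondCountableTopology M]
  [ChartedSpace (EuclideanSpace ℝ (Fin 4)) M] [IsManifold (𝓡 4) ∞ M] [CompactSpace M]
  [T3Space M] [MeasurableSpace M] [BorelSpace M]
  (g : PseudoRiemannianMetric (𝓡 4) ∞ (EuclideanSpace ℝ (Fin 4)) (TangentSpace (𝓡 4) : M → Type _))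

/-! ### The localisation step -/

/-- **Two-piece localisation of the weighted clause** (small scales of the round-capped blow-up).
See the module docstring: with `χ₁² + χ₂² = 1` smooth, `tsupport χᵢ ⊆ Uᵢ`, the `ψ`-weighted clause on
`Uᵢ` at level `Lᵢ` (scale `τ`), the Yamabe–Sobolev bound with constant `Y`, `√(∫(Σ|∇χᵢ|²_g)²) ≤ Θ`,
`L < 0` and `L + (4/Y)·max(C_Y, 0)·Θ ≤ Lᵢ`, every normalised smooth `w` has `L ≤ E(w)`.
[cite: Perelman2002Entropy, §3.1; Cycon–Froese–Kirsch–Simon 1987, Thm. 3.2] -/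
theorem localised_clause [g.HasLeviCivita] (hg : g.IsRiemannian) {τ Y Θ L L₁ L₂ : ℝ} (hτ : 0 < τ)
    (hY : 0 < Y) {ψ χ₁ χ₂ : M → ℝ} (hψ : ContMDiff (𝓡 4) 𝓘(ℝ, ℝ) ∞ ψ) (hψpos : ∀ x, 0 < ψ x)
    (hLψ : ∀ x, 0 < g.scalarCurvature x * ψ x - 6 * g.dalembertian ψ x)
    (hχ₁ : ContMDiff (𝓡 4) 𝓘(ℝ, ℝ) ∞ χ₁) (hχ₂ : ContMDiff (𝓡 4) 𝓘(ℝ, ℝ) ∞ χ₂)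
    (h1 : ∀ y, χ₁ y ^ 2 + χ₂ y ^ 2 = 1) {U₁ U₂ : Set M} (hU₁ : tsupport χ₁ ⊆ U₁) (hU₂ : tsupport χ₂ ⊆ U₂)
    (hcl₁ : ∀ v : M → ℝ, ContMDiff (𝓡 4) 𝓘(ℝ, ℝ) ∞ v → tsupport v ⊆ U₁ →
      ∫ x, (4 * Real.pi * τ) ^ (-(4 : ℝ) / 2) * (v x) ^ 2 * (ψ x) ^ 4
          ∂(riemannianMeasure (g.toContMDiffRiemannianMetric hg)) = 1 →
        L₁ ≤ ∫ x, (τ * ((ψ x ^ 3)⁻¹ * (g.scalarCurvature x * ψ x - 6 * g.dalembertian ψ x) * (v x) ^ 2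
              + 4 * ((ψ x)⁻¹ ^ 2 * g.gradSq v x))
            - (v x) ^ 2 * Real.log ((v x) ^ 2) - 4 * (v x) ^ 2)
            * ((4 * Real.pi * τ) ^ (-(4 : ℝ) / 2) * (ψ x) ^ 4)
          ∂(riemannianMeasure (g.toContMDiffRiemannianMetric hg)))
    (hcl₂ : ∀ v : M → ℝ, ContMDiff (𝓡 4) 𝓘(ℝ, ℝ) ∞ v → tsupport v ⊆ U₂ →
      ∫ x, (4 * Real.pi * τ) ^ (-(4 : ℝ) / 2) * (v x) ^ 2 * (ψ x) ^ 4
          ∂(riemannianMeasure (g.toContMDiffRiemannianMetric hg)) = 1 →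
        L₂ ≤ ∫ x, (τ * ((ψ x ^ 3)⁻¹ * (g.scalarCurvature x * ψ x - 6 * g.dalembertian ψ x) * (v x) ^ 2
              + 4 * ((ψ x)⁻¹ ^ 2 * g.gradSq v x))
            - (v x) ^ 2 * Real.log ((v x) ^ 2) - 4 * (v x) ^ 2)
            * ((4 * Real.pi * τ) ^ (-(4 : ℝ) / 2) * (ψ x) ^ 4)
          ∂(riemannianMeasure (g.toContMDiffRiemannianMetric hg)))
    (hYS : ∀ u : M → ℝ, ContMDiff (𝓡 4) 𝓘(ℝ, ℝ) ∞ u →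
      Y * Real.sqrt (∫ x, u x ^ 4 * ψ x ^ 4 ∂(riemannianMeasure (g.toContMDiffRiemannianMetric hg))) ≤
        ∫ x, (6 * (ψ x ^ 2 * g.gradSq u x)
            + ψ x * (g.scalarCurvature x * ψ x - 6 * g.dalembertian ψ x) * u x ^ 2)
          ∂(riemannianMeasure (g.toContMDiffRiemannianMetric hg)))
    (hΘ : Real.sqrt (∫ x, (g.gradSq χ₁ x + g.gradSq χ₂ x) ^ 2
      ∂(riemannianMeasure (g.toContMDiffRiemannianMetric hg))) ≤ Θ)
    (hL : L < 0)
    (hL₁ : L + 4 / Y * max (3 * (4 + 2 * Real.log (4 * Real.pi) - 2 * Real.log Y) + 6 * Real.log 6 - 6) 0 * Θ ≤ L₁)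
    (hL₂ : L + 4 / Y * max (3 * (4 + 2 * Real.log (4 * Real.pi) - 2 * Real.log Y) + 6 * Real.log 6 - 6) 0 * Θ ≤ L₂) :
    ∀ w : M → ℝ, ContMDiff (𝓡 4) 𝓘(ℝ, ℝ) ∞ w →
      ∫ x, (4 * Real.pi * τ) ^ (-(4 : ℝ) / 2) * (w x) ^ 2 * (ψ x) ^ 4
          ∂(riemannianMeasure (g.toContMDiffRiemannianMetric hg)) = 1 →
        L ≤ ∫ x, (τ * ((ψ x ^ 3)⁻¹ * (g.scalarCurvature x * ψ x - 6 * g.dalembertian ψ x) * (w x) ^ 2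
              + 4 * ((ψ x)⁻¹ ^ 2 * g.gradSq w x))
            - (w x) ^ 2 * Real.log ((w x) ^ 2) - 4 * (w x) ^ 2)
            * ((4 * Real.pi * τ) ^ (-(4 : ℝ) / 2) * (ψ x) ^ 4)
          ∂(riemannianMeasure (g.toContMDiffRiemannianMetric hg)) := by
  intro w hw hnorm
  -- the easy case
  by_cases hEw : 0 ≤ ∫ x, (τ * ((ψ x ^ 3)⁻¹ * (g.scalarCurvature x * ψ x - 6 * g.dalembertian ψ x) * (w x) ^ 2
        + 4 * ((ψ x)⁻¹ ^ 2 * g.gradSq w x))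
      - (w x) ^ 2 * Real.log ((w x) ^ 2) - 4 * (w x) ^ 2)
      * ((4 * Real.pi * τ) ^ (-(4 : ℝ) / 2) * (ψ x) ^ 4)
      ∂(riemannianMeasure (g.toContMDiffRiemannianMetric hg))
  · exact hL.le.trans hEw
  have hEw' := lt_of_not_ge hEw
  -- regularity
  have hψc : Continuous ψ := hψ.continuous
  have hwc : Continuous w := hw.continuous
  have hψ2 : ContMDiff (𝓡 4) 𝓘(ℝ, ℝ) 2 ψ := hψ.of_le (WithTop.coe_le_coe.mpr le_top)
  have hrc : Continuous fun x ↦ (ψ x ^ 3)⁻¹ * (g.scalarCurvature x * ψ x - 6 * g.dalembertian ψ x) := by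
    have hΔ : Continuous (g.dalembertian ψ) := continuous_dalembertian g hψ2
    have hR : Continuous g.scalarCurvature := g.contMDiff_scalarCurvature.continuous
    exact ((hψc.pow 3).inv₀ fun x ↦ (pow_pos (hψpos x) 3).ne').mul
      ((hR.mul hψc).sub (continuous_const.mul hΔ))
  have hr0 : ∀ x, 0 ≤ (ψ x ^ 3)⁻¹ * (g.scalarCurvature x * ψ x - 6 * g.dalembertian ψ x) := fun x ↦
    (mul_pos (inv_pos.2 (pow_pos (hψpos x) 3)) (hLψ x)).le
  have hrψ : ∀ x, ψ x * (g.scalarCurvature x * ψ x - 6 * g.dalembertian ψ x) =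
      (ψ x) ^ 4 * ((ψ x ^ 3)⁻¹ * (g.scalarCurvature x * ψ x - 6 * g.dalembertian ψ x)) := by
    intro x
    have hψx : ψ x ≠ 0 := (hψpos x).ne'
    field_simp
  -- the realised metric `ψ² g` and IMS for it, read on `g`
  obtain ⟨g', hg', hval⟩ := ConformalRealisation.exists_isRiemannian_conformal_sq g hg hψ hψpos
  haveI hLC' : g'.HasLeviCivita := g'.hasLeviCivita
  have hnorm' : ∫ x, (4 * Real.pi * τ) ^ (-(4 : ℝ) / 2) * w x ^ 2
      ∂(riemannianMeasure (g'.toContMDiffRiemannianMetric hg')) = 1 := by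
    rw [integral_conformal hg hg' hψ hval, ← hnorm]
  have hIMS := wEntropy_localisation_two M g' hg' τ hτ χ₁ χ₂ w hχ₁ hχ₂ hw h1 hnorm'
  rw [functional_conformal hg hg' hψ hψpos hval τ (fun y ↦ χ₁ y * w y),
    functional_conformal hg hg' hψ hψpos hval τ (fun y ↦ χ₂ y * w y),
    functional_conformal hg hg' hψ hψpos hval τ w,
    integral_conformal hg hg' hψ hval (fun x ↦ (4 * Real.pi * τ) ^ (-(4 : ℝ) / 2) * w x ^ 2 * χ₁ x ^ 2),
    integral_conformal hg hg' hψ hval (fun x ↦ (4 * Real.pi * τ) ^ (-(4 : ℝ) / 2) * w x ^ 2 * χ₂ x ^ 2),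
    cost_conformal hg hg' hψ hψpos hval ((4 * Real.pi * τ) ^ (-(4 : ℝ) / 2)) w χ₁ χ₂] at hIMS
  beta_reduce at hIMS
  -- masses
  have iM : ∀ χ : M → ℝ, Continuous χ →
      Integrable (fun x ↦ (4 * Real.pi * τ) ^ (-(4 : ℝ) / 2) * w x ^ 2 * χ x ^ 2 * ψ x ^ 4)
        (riemannianMeasure (g.toContMDiffRiemannianMetric hg)) :=
    fun χ hχ ↦ EntropyLocalisation.integrable_of_continuous g hg
      (((continuous_const.mul (hwc.pow 2)).mul (hχ.pow 2)).mul (hψc.pow 4))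
  have hmsum : (∫ x, (4 * Real.pi * τ) ^ (-(4 : ℝ) / 2) * w x ^ 2 * χ₁ x ^ 2 * ψ x ^ 4
        ∂(riemannianMeasure (g.toContMDiffRiemannianMetric hg))) +
      (∫ x, (4 * Real.pi * τ) ^ (-(4 : ℝ) / 2) * w x ^ 2 * χ₂ x ^ 2 * ψ x ^ 4
        ∂(riemannianMeasure (g.toContMDiffRiemannianMetric hg))) = 1 := by
    rw [← integral_add (iM χ₁ hχ₁.continuous) (iM χ₂ hχ₂.continuous), ← hnorm]
    refine integral_congr_ae (ae_of_all _ fun x ↦ ?_)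
    have := h1 x
    dsimp only
    linear_combination ((4 * Real.pi * τ) ^ (-(4 : ℝ) / 2) * w x ^ 2 * ψ x ^ 4) * this
  have hmass : ∀ χ : M → ℝ,
      ∫ x, (4 * Real.pi * τ) ^ (-(4 : ℝ) / 2) * (χ x * w x) ^ 2 * (ψ x) ^ 4
          ∂(riemannianMeasure (g.toContMDiffRiemannianMetric hg)) =
        ∫ x, (4 * Real.pi * τ) ^ (-(4 : ℝ) / 2) * w x ^ 2 * χ x ^ 2 * ψ x ^ 4
          ∂(riemannianMeasure (g.toContMDiffRiemannianMetric hg)) := by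
    intro χ
    refine integral_congr_ae (ae_of_all _ fun x ↦ ?_)
    dsimp only
    ring
  have hm₁0 : 0 ≤ ∫ x, (4 * Real.pi * τ) ^ (-(4 : ℝ) / 2) * w x ^ 2 * χ₁ x ^ 2 * ψ x ^ 4
      ∂(riemannianMeasure (g.toContMDiffRiemannianMetric hg)) := integral_nonneg fun x ↦ by positivity
  have hm₂0 : 0 ≤ ∫ x, (4 * Real.pi * τ) ^ (-(4 : ℝ) / 2) * w x ^ 2 * χ₂ x ^ 2 * ψ x ^ 4
      ∂(riemannianMeasure (g.toContMDiffRiemannianMetric hg)) := integral_nonneg fun x ↦ by positivity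
  -- the two pieces
  have hp₁ := piece_ge_of_clause g hg hτ hψ hψpos
    (r := fun x ↦ (ψ x ^ 3)⁻¹ * (g.scalarCurvature x * ψ x - 6 * g.dalembertian ψ x)) hrc hr0 hcl₁
    (u := fun y ↦ χ₁ y * w y) (hχ₁.mul hw) ((tsupport_mul_subset_left).trans hU₁)
  have hp₂ := piece_ge_of_clause g hg hτ hψ hψpos
    (r := fun x ↦ (ψ x ^ 3)⁻¹ * (g.scalarCurvature x * ψ x - 6 * g.dalembertian ψ x)) hrc hr0 hcl₂
    (u := fun y ↦ χ₂ y * w y) (hχ₂.mul hw) ((tsupport_mul_subset_left).trans hU₂)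
  beta_reduce at hp₁ hp₂
  rw [hmass χ₁] at hp₁
  rw [hmass χ₂] at hp₂
  -- the cost
  have hQc : Continuous fun x ↦ g.gradSq χ₁ x + g.gradSq χ₂ x :=
    (Literature.Geometry.Riemannian.contMDiff_gradSq g hχ₁).continuous.add
      (Literature.Geometry.Riemannian.contMDiff_gradSq g hχ₂).continuous
  have hQ0 : ∀ x, 0 ≤ g.gradSq χ₁ x + g.gradSq χ₂ x := fun x ↦
    add_nonneg (g.gradSq_nonneg hg χ₁ x) (g.gradSq_nonneg hg χ₂ x)
  have hGw : Continuous (g.gradSq w) := (Literature.Geometry.Riemannian.contMDiff_gradSq g hw).continuous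
  have hYSw : Y * Real.sqrt (∫ x, (w x) ^ 4 * (ψ x) ^ 4 ∂(riemannianMeasure (g.toContMDiffRiemannianMetric hg))) ≤
      ∫ x, (6 * ((ψ x) ^ 2 * g.gradSq w x)
        + (ψ x) ^ 4 * ((ψ x ^ 3)⁻¹ * (g.scalarCurvature x * ψ x - 6 * g.dalembertian ψ x)) * (w x) ^ 2)
        ∂(riemannianMeasure (g.toContMDiffRiemannianMetric hg)) := by
    have h := hYS w hw
    have heq : ∫ x, (6 * (ψ x ^ 2 * g.gradSq w x)
        + ψ x * (g.scalarCurvature x * ψ x - 6 * g.dalembertian ψ x) * w x ^ 2)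
        ∂(riemannianMeasure (g.toContMDiffRiemannianMetric hg)) =
        ∫ x, (6 * ((ψ x) ^ 2 * g.gradSq w x)
          + (ψ x) ^ 4 * ((ψ x ^ 3)⁻¹ * (g.scalarCurvature x * ψ x - 6 * g.dalembertian ψ x)) * (w x) ^ 2)
          ∂(riemannianMeasure (g.toContMDiffRiemannianMetric hg)) := by
      refine integral_congr_ae (ae_of_all _ fun x ↦ ?_)
      dsimp only
      rw [hrψ x]
    rw [heq] at h
    exact h
  have hcost := gluingCutoffCost M g hg τ Y hτ hY w ψ
    (fun x ↦ (ψ x ^ 3)⁻¹ * (g.scalarCurvature x * ψ x - 6 * g.dalembertian ψ x)) (g.gradSq w)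
    (fun x ↦ g.gradSq χ₁ x + g.gradSq χ₂ x) hwc hψc hrc hGw hQc hQ0 hψpos hr0 hnorm hYSw hEw'
  beta_reduce at hcost
  have hΘ0 : 0 ≤ Θ := (Real.sqrt_nonneg _).trans hΘ
  have hcost' : 4 * τ * ∫ x, (4 * Real.pi * τ) ^ (-(4 : ℝ) / 2) * (w x) ^ 2 * (ψ x) ^ 2
      * (g.gradSq χ₁ x + g.gradSq χ₂ x) ∂(riemannianMeasure (g.toContMDiffRiemannianMetric hg)) ≤
      4 / Y * max (3 * (4 + 2 * Real.log (4 * Real.pi) - 2 * Real.log Y) + 6 * Real.log 6 - 6) 0 * Θ := by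
    refine hcost.trans ?_
    have hS0 : 0 ≤ Real.sqrt (∫ x, (g.gradSq χ₁ x + g.gradSq χ₂ x) ^ 2
        ∂(riemannianMeasure (g.toContMDiffRiemannianMetric hg))) := Real.sqrt_nonneg _
    calc 4 / Y * (3 * (4 + 2 * Real.log (4 * Real.pi) - 2 * Real.log Y) + 6 * Real.log 6 - 6) *
          Real.sqrt (∫ x, (g.gradSq χ₁ x + g.gradSq χ₂ x) ^ 2 ∂(riemannianMeasure (g.toContMDiffRiemannianMetric hg)))
        ≤ 4 / Y * max (3 * (4 + 2 * Real.log (4 * Real.pi) - 2 * Real.log Y) + 6 * Real.log 6 - 6) 0 *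
          Real.sqrt (∫ x, (g.gradSq χ₁ x + g.gradSq χ₂ x) ^ 2 ∂(riemannianMeasure (g.toContMDiffRiemannianMetric hg))) := by
          refine mul_le_mul_of_nonneg_right ?_ hS0
          exact mul_le_mul_of_nonneg_left (le_max_left _ _) (by positivity)
      _ ≤ 4 / Y * max (3 * (4 + 2 * Real.log (4 * Real.pi) - 2 * Real.log Y) + 6 * Real.log 6 - 6) 0 * Θ :=
          mul_le_mul_of_nonneg_left hΘ (by positivity)
  -- assemble (all terms are now syntactically aligned)
  set μ : Measure M := riemannianMeasure (g.toContMDiffRiemannianMetric hg) with hμ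
  set c : ℝ := (4 * Real.pi * τ) ^ (-(4 : ℝ) / 2) with hc
  set cb : ℝ := 4 / Y * max (3 * (4 + 2 * Real.log (4 * Real.pi) - 2 * Real.log Y) + 6 * Real.log 6 - 6) 0 * Θ
    with hcb
  set m₁ : ℝ := ∫ x, c * w x ^ 2 * χ₁ x ^ 2 * ψ x ^ 4 ∂μ with hm₁
  set m₂ : ℝ := ∫ x, c * w x ^ 2 * χ₂ x ^ 2 * ψ x ^ 4 ∂μ with hm₂
  have hlev : L + cb ≤ m₁ * L₁ + m₂ * L₂ := by
    have h1' := mul_le_mul_of_nonneg_left hL₁ hm₁0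
    have h2' := mul_le_mul_of_nonneg_left hL₂ hm₂0
    have h3 : (m₁ + m₂) * (L + cb) = L + cb := by rw [hmsum, one_mul]
    linarith [h1', h2', h3]
  linarith [hIMS, hp₁, hp₂, hcost', hlev]

end GluingLocalisation

/-- **Two-piece localisation of the weighted clause** (registered sub-goal `gluingLocalisedClause` of
Stub D of line `green-blowup-conformal-entropy`; ∀-form of `GluingLocalisation.localised_clause`): IMS
localisation for the realised metric `ψ²g` + the energy/cut-off cost bound for sub-zero test functions
+ normalisation of the pieces + Jensen mixing. [cite: Perelman2002Entropy, §3.1] -/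
theorem gluingLocalisedClause :
    ∀ (M : Type) [TopologicalSpace M] [T2Space M] [SecondCountableTopology M]
      [ChartedSpace (EuclideanSpace ℝ (Fin 4)) M] [IsManifold (𝓡 4) ∞ M] [CompactSpace M]
      [T3Space M] [MeasurableSpace M] [BorelSpace M]
      (g : PseudoRiemannianMetric (𝓡 4) ∞ (EuclideanSpace ℝ (Fin 4)) (TangentSpace (𝓡 4) : M → Type _))
      [g.HasLeviCivita] (hg : g.IsRiemannian) (τ Y Θ L L₁ L₂ : ℝ), 0 < τ → 0 < Y →
      ∀ (ψ χ₁ χ₂ : M → ℝ), ContMDiff (𝓡 4) 𝓘(ℝ, ℝ) ∞ ψ → (∀ x, 0 < ψ x) →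
      (∀ x, 0 < g.scalarCurvature x * ψ x - 6 * g.dalembertian ψ x) →
      ContMDiff (𝓡 4) 𝓘(ℝ, ℝ) ∞ χ₁ → ContMDiff (𝓡 4) 𝓘(ℝ, ℝ) ∞ χ₂ → (∀ y, χ₁ y ^ 2 + χ₂ y ^ 2 = 1) →
      ∀ (U₁ U₂ : Set M), tsupport χ₁ ⊆ U₁ → tsupport χ₂ ⊆ U₂ →
      (∀ v : M → ℝ, ContMDiff (𝓡 4) 𝓘(ℝ, ℝ) ∞ v → tsupport v ⊆ U₁ →
        ∫ x, (4 * Real.pi * τ) ^ (-(4 : ℝ) / 2) * (v x) ^ 2 * (ψ x) ^ 4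
            ∂(riemannianMeasure (g.toContMDiffRiemannianMetric hg)) = 1 →
          L₁ ≤ ∫ x, (τ * ((ψ x ^ 3)⁻¹ * (g.scalarCurvature x * ψ x - 6 * g.dalembertian ψ x) * (v x) ^ 2
                + 4 * ((ψ x)⁻¹ ^ 2 * g.gradSq v x))
              - (v x) ^ 2 * Real.log ((v x) ^ 2) - 4 * (v x) ^ 2)
              * ((4 * Real.pi * τ) ^ (-(4 : ℝ) / 2) * (ψ x) ^ 4)
            ∂(riemannianMeasure (g.toContMDiffRiemannianMetric hg))) →
      (∀ v : M → ℝ, ContMDiff (𝓡 4) 𝓘(ℝ, ℝ) ∞ v → tsupport v ⊆ U₂ →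
        ∫ x, (4 * Real.pi * τ) ^ (-(4 : ℝ) / 2) * (v x) ^ 2 * (ψ x) ^ 4
            ∂(riemannianMeasure (g.toContMDiffRiemannianMetric hg)) = 1 →
          L₂ ≤ ∫ x, (τ * ((ψ x ^ 3)⁻¹ * (g.scalarCurvature x * ψ x - 6 * g.dalembertian ψ x) * (v x) ^ 2
                + 4 * ((ψ x)⁻¹ ^ 2 * g.gradSq v x))
              - (v x) ^ 2 * Real.log ((v x) ^ 2) - 4 * (v x) ^ 2)
              * ((4 * Real.pi * τ) ^ (-(4 : ℝ) / 2) * (ψ x) ^ 4)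
            ∂(riemannianMeasure (g.toContMDiffRiemannianMetric hg))) →
      (∀ u : M → ℝ, ContMDiff (𝓡 4) 𝓘(ℝ, ℝ) ∞ u →
        Y * Real.sqrt (∫ x, u x ^ 4 * ψ x ^ 4 ∂(riemannianMeasure (g.toContMDiffRiemannianMetric hg))) ≤
          ∫ x, (6 * (ψ x ^ 2 * g.gradSq u x)
              + ψ x * (g.scalarCurvature x * ψ x - 6 * g.dalembertian ψ x) * u x ^ 2)
            ∂(riemannianMeasure (g.toContMDiffRiemannianMetric hg))) →
      Real.sqrt (∫ x, (g.gradSq χ₁ x + g.gradSq χ₂ x) ^ 2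
        ∂(riemannianMeasure (g.toContMDiffRiemannianMetric hg))) ≤ Θ →
      L < 0 →
      L + 4 / Y * max (3 * (4 + 2 * Real.log (4 * Real.pi) - 2 * Real.log Y) + 6 * Real.log 6 - 6) 0 * Θ ≤ L₁ →
      L + 4 / Y * max (3 * (4 + 2 * Real.log (4 * Real.pi) - 2 * Real.log Y) + 6 * Real.log 6 - 6) 0 * Θ ≤ L₂ →
      ∀ w : M → ℝ, ContMDiff (𝓡 4) 𝓘(ℝ, ℝ) ∞ w →
        ∫ x, (4 * Real.pi * τ) ^ (-(4 : ℝ) / 2) * (w x) ^ 2 * (ψ x) ^ 4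
            ∂(riemannianMeasure (g.toContMDiffRiemannianMetric hg)) = 1 →
          L ≤ ∫ x, (τ * ((ψ x ^ 3)⁻¹ * (g.scalarCurvature x * ψ x - 6 * g.dalembertian ψ x) * (w x) ^ 2
                + 4 * ((ψ x)⁻¹ ^ 2 * g.gradSq w x))
              - (w x) ^ 2 * Real.log ((w x) ^ 2) - 4 * (w x) ^ 2)
              * ((4 * Real.pi * τ) ^ (-(4 : ℝ) / 2) * (ψ x) ^ 4)
            ∂(riemannianMeasure (g.toContMDiffRiemannianMetric hg)) := by
  intro M _ _ _ _ _ _ _ _ _ g _ hg τ Y Θ L L₁ L₂ hτ hY ψ χ₁ χ₂ hψ hψpos hLψ hχ₁ hχ₂ h1 U₁ U₂ hU₁ hU₂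
    hcl₁ hcl₂ hYS hΘ hL hL₁ hL₂
  exact GluingLocalisation.localised_clause g hg hτ hY hψ hψpos hLψ hχ₁ hχ₂ h1 hU₁ hU₂ hcl₁ hcl₂ hYS hΘ
    hL hL₁ hL₂

end Summit.SmoothPoincare4.SmoothPoincare4.Theorems

end
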